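import Summits.AtomisticToContinuum.Crystallization.Theses.HcpThetaUniversality
import Summits.AtomisticToContinuum.Crystallization.Theorems.ThreeConeCertificateDefectVanishCrystallizes
import Literature.MathematicalPhysics.StatisticalMechanics.LennardJonesClusters

/-!
# Birth skeleton (BC3) for crux `HcpThetaUniversality.NearMaxGroundStatesCrystallize`
# (item stmt-AtomisticToContinuum-5057, rank 3 of route-AtomisticToContinuum-HcpThetaUniversality;
#  shared with route-AtomisticToContinuum-VdwKissingSutherland) — published as `Lines/birth.lean`

The crux (RIGIDITY ENDGAME): IF every sequence of Lennard-Jones ground states `x^N` is, eventually in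
`N`, a `1/20`-per-particle near-maximiser of the `r⁻⁶` unit-packing problem after discarding `≤ N/1000`
particles (kept set `S`) and dilating by `c ∈ [1, 53/50]` (near-maximal against EVERY finite unit packing
`y` of `M` points: `#S·(S₆(y)/M − 1/20) ≤ S₆(c·x^N|S)`), THEN `IsCrystallizing lennardJones 3`.

This skeleton is the route header's own foreseen glued split (TWO-LAYER PLAN of the route file:
`NearMaxGroundStatesCrystallize ⇐ PackingStabilityTwelve → LjSelfImprovement → DefectVanishCrystallizes`),
typed so that it ELABORATES and so that the last arrow is the LANDED theorem
`ThreeConeCertificateDefectVanishCrystallizes.isCrystallizing_of_bulkDefectVanish` (item 0752, proved)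
together with the proved fact `LennardJonesMinimalDistance_holds`. Three registered stubs:

* `stub_packingStabilityTwelve` (S1, PURE FINITE GEOMETRY, size L; the "stability modulus of the r⁻⁶
  packing problem" that the route names as the unknown): a finite configuration that is a unit packing
  on `S` at scale `c > 0` and a `1/20`-per-site near-maximiser of the `r⁻⁶` double sum against every
  finite unit packing has a MAJORITY of its sites exactly twelve-coordinated within `26/25` (packing
  units: twelve `j ∈ S`, `j ≠ i`, with `c·dist ≤ 26/25`). Why `26/25` and "majority": `R_min(13) =
  1.0456 > 26/25` (Tammes-13 / DLP, arXiv:1009.3003 p. 3), so thirteen within `26/25` is impossible and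
  the only failure modes are missing / stretched contacts; a missing or `> 26/25` contact costs
  `≥ 1 − (26/25)⁻⁶ ≈ 0.21` of site sum, a vacancy `≈ 14.4` for twelve bad sites, a stretched layer gap
  `≈ 0.7` per bad site, against a budget of `1/20` per site — naive bad fraction `≤ 0.05/0.21 < 1/4`, so
  "majority" carries a factor `> 2` of slack and is not a tuned threshold (checklist 4c(iv)). It is
  FALSE iff near-maximisers of the averaged `r⁻⁶` packing problem are not close-packed-coordinated —
  which is the route's own kill criterion (SutherlandBound dies).
* `stub_ljSelfImprovement` (S2, LJ-SPECIFIC, size XL, the HARDEST stub — it carries the crux's named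
  open difficulty "no self-improvement mechanism in print"): if every LJ ground-state sequence is
  eventually majority-twelve-coordinated after `(1/1000, [1, 53/50])`-cleaning (the output of S1 on the
  crux hypothesis), then SOFT TWELVE-COORDINATION holds at the LJ scale: for every `η ∈ (0, 3/10)` the
  fraction of particles without exactly twelve others within `1 + η` and none in `(1 + η, 5/4)` tends to
  `0` (verbatim the statement `CrystalKissingRigidity.SoftTwelveCoordination`, item 0750, inlined here so
  that this file does not import a retired route file). The hypothesis pins the scale (`c ∈ [1, 1.06]`,
  `c·d_min ≥ 1` on `S`) and excludes icosahedral-majority local order (an icosahedral shell site has its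
  five ring neighbours at `1.0515 > 26/25` in packing units); exact LJ minimality (Flyspeck `L12` cap,
  `E(N) ≤ N·e(hcp) + O(N^{2/3})`, bond/elastic/tail bookkeeping) must upgrade "majority" to "density one".
* `stub_softTwelveBulkDefectVanish` (S3, GEOMETRIC RIGIDITY + STACKING SELECTION, size XL): soft
  twelve-coordination implies the shared hinge `ThreeConeCertificate.BulkDefectVanish` (item 0751, open,
  wanted by ten routes: ONE periodic `P` such that all but `o(N)` particles are two-way `ε`-matched on
  `B_R` to a rotated copy of `P` rooted at the particle) — robust Fejes Tóth–Hales twelve-shell rigidity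
  (Hales2012 Thm 1 / Lemma 2 at `η = 0`; the `η > 0` version with rate is open, cf. retired item 0758)
  plus stacking selection by the `r⁻⁶` tail (Hägg domination 0716/0737) with `O(N^{2/3})`-many fault
  planes. Inherits 0751's recorded caveat (one `P` rooted at every good particle forces a
  vertex-transitive limit: fine for hcp/fcc, false for dhcp-type polytypes).

Layout: §0 the three stub statements as named Props `Goal.stub_*` (verbatim the stub signatures), §1 the registered
stubs `theorem stub_* : <inlined signature> := by sorry`, §2 the composition. Composition
`NearMaxGroundStatesCrystallize_of : Goal.stub_packingStabilityTwelve → Goal.stub_ljSelfImprovement →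
Goal.stub_softTwelveBulkDefectVanish → crux` is a real proof (no `sorry`):
the crux hypothesis and S1 give S2's hypothesis (`filter_upwards`), S2 then S3 give `BulkDefectVanish`,
and `isCrystallizing_of_bulkDefectVanish` with `LennardJonesMinimalDistance_holds` (`δ = 1/3`) gives
`IsCrystallizing lennardJones 3`. Sorries: exactly three, one per `stub_*`, none elsewhere.

Disproof used: none exists for this crux (`ledger crux ls stmt-AtomisticToContinuum-5057`: no workfiles,
no `Disproof.lean`, no `Negative/` lemmas, 2026-08-17); dead lines: none recorded. Negatives index
(20 refuted statements of the summit, 4 on Crystallization: GappedShellCensus.ShellCensus 15929,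
SpectralChargeLedger 17253, BrittleMieDescent.EffectiveLocalHales 4146, OneGrainWindow.OneGrainGluing
3506): no stub restates any of them (S1–S3 make no twelve-shell PATTERN claim and no one-grain gluing
claim). BC3 probes (folder `bc/probe_*.lean`): for each stub, `stub → crux` and `stub → Crystallization`
by `first | exact? | simpa | aesop` fail (recorded in the registrar's NOTES.md).
-/

namespace Summit.AtomisticToContinuum.Crystallization.Cruxes.NearMaxGroundStatesCrystallize.Birth

open scoped BigOperators
open Filter

/-! ## §0 The three stub STATEMENTS as named propositions (namespace `Goal`; each is, character for character,
the signature of the registered stub of the same short name in §1 — the composition `NearMaxGroundStatesCrystallize_of`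
takes them BY NAME, which is what `#h21_check_skeleton` admits as hypotheses) -/

namespace Goal

/-- Statement of S1 `stub_packingStabilityTwelve` (see §1). -/
def stub_packingStabilityTwelve : Prop :=
  ∀ (N : ℕ) (x : Fin N → EuclideanSpace ℝ (Fin 3)) (S : Finset (Fin N)) (c : ℝ), 0 < c →
      (∀ i ∈ S, ∀ j ∈ S, i ≠ j → 1 ≤ c * dist (x i) (x j)) →
      (∀ (M : ℕ) (y : Fin M → EuclideanSpace ℝ (Fin 3)), (∀ i j, i ≠ j → 1 ≤ dist (y i) (y j)) →
        (S.card : ℝ) * ((∑ i, ∑ j, (dist (y i) (y j))⁻¹ ^ 6) / M - 1 / 20) ≤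
          ∑ i ∈ S, ∑ j ∈ S, (c * dist (x i) (x j))⁻¹ ^ 6) →
      S.card ≤ 2 * Nat.card {i : Fin N // i ∈ S ∧
        Nat.card {j : Fin N // j ∈ S ∧ j ≠ i ∧ c * dist (x i) (x j) ≤ 26 / 25} = 12}

/-- Statement of S2 `stub_ljSelfImprovement` (see §1). -/
def stub_ljSelfImprovement : Prop :=
  (∀ x : (N : ℕ) → (Fin N → EuclideanSpace ℝ (Fin 3)),
      (∀ N, Literature.MathematicalPhysics.StatisticalMechanics.IsGroundState
        Literature.MathematicalPhysics.StatisticalMechanics.lennardJones (x N)) →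
      ∀ᶠ N in Filter.atTop, ∃ (S : Finset (Fin N)) (c : ℝ), 1000 * ((N : ℝ) - S.card) ≤ N ∧ 1 ≤ c ∧
        c ≤ 53 / 50 ∧ (∀ i ∈ S, ∀ j ∈ S, i ≠ j → 1 ≤ c * dist (x N i) (x N j)) ∧
        S.card ≤ 2 * Nat.card {i : Fin N // i ∈ S ∧
          Nat.card {j : Fin N // j ∈ S ∧ j ≠ i ∧ c * dist (x N i) (x N j) ≤ 26 / 25} = 12}) →
    ∀ η : ℝ, 0 < η → η < 3 / 10 → ∀ x : (N : ℕ) → (Fin N → EuclideanSpace ℝ (Fin 3)),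
      (∀ N, Literature.MathematicalPhysics.StatisticalMechanics.IsGroundState
        Literature.MathematicalPhysics.StatisticalMechanics.lennardJones (x N)) →
      Filter.Tendsto (fun N : ℕ => (Nat.card {i : Fin N // ¬ (Nat.card {j : Fin N // j ≠ i ∧
        dist (x N i) (x N j) ≤ 1 + η} = 12 ∧ ∀ j : Fin N, j ≠ i → dist (x N i) (x N j) ≤ 1 + η ∨
        5 / 4 ≤ dist (x N i) (x N j))} : ℝ) / N) Filter.atTop (nhds 0)

/-- Statement of S3 `stub_softTwelveBulkDefectVanish` (see §1). -/
def stub_softTwelveBulkDefectVanish : Prop :=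
  (∀ η : ℝ, 0 < η → η < 3 / 10 → ∀ x : (N : ℕ) → (Fin N → EuclideanSpace ℝ (Fin 3)),
      (∀ N, Literature.MathematicalPhysics.StatisticalMechanics.IsGroundState
        Literature.MathematicalPhysics.StatisticalMechanics.lennardJones (x N)) →
      Filter.Tendsto (fun N : ℕ => (Nat.card {i : Fin N // ¬ (Nat.card {j : Fin N // j ≠ i ∧
        dist (x N i) (x N j) ≤ 1 + η} = 12 ∧ ∀ j : Fin N, j ≠ i → dist (x N i) (x N j) ≤ 1 + η ∨
        5 / 4 ≤ dist (x N i) (x N j))} : ℝ) / N) Filter.atTop (nhds 0)) →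
    Summit.AtomisticToContinuum.Crystallization.Theses.ThreeConeCertificate.BulkDefectVanish

end Goal

/-! ## §1 Registered stubs (the ONLY `sorry`s of the file; signatures fully inlined and qualified) -/

/-- **S1 — packing stability of the `r⁻⁶` problem at deficit `1/20` (pure finite geometry, size L).**
A finite configuration `x` that is a unit packing on the kept set `S` at scale `c > 0` and whose scaled
`r⁻⁶` double sum over `S × S` is within `#S/20` of `#S · S₆(y)/M` for EVERY finite unit packing `y` of
`M` points has at least half of its kept sites exactly twelve-coordinated within `26/25` (scaled units).
Sources: HopkinsStillingerTorquato2011 / arXiv:1009.3003 (`R_min(13) = 1.0456`), MusinTarasov2012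
(Tammes-13), Hales2012, Stillinger2001 (lattice sums `L₆(hcp) = 14.4549`). -/
theorem stub_packingStabilityTwelve :
    ∀ (N : ℕ) (x : Fin N → EuclideanSpace ℝ (Fin 3)) (S : Finset (Fin N)) (c : ℝ), 0 < c →
      (∀ i ∈ S, ∀ j ∈ S, i ≠ j → 1 ≤ c * dist (x i) (x j)) →
      (∀ (M : ℕ) (y : Fin M → EuclideanSpace ℝ (Fin 3)), (∀ i j, i ≠ j → 1 ≤ dist (y i) (y j)) →
        (S.card : ℝ) * ((∑ i, ∑ j, (dist (y i) (y j))⁻¹ ^ 6) / M - 1 / 20) ≤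
          ∑ i ∈ S, ∑ j ∈ S, (c * dist (x i) (x j))⁻¹ ^ 6) →
      S.card ≤ 2 * Nat.card {i : Fin N // i ∈ S ∧
        Nat.card {j : Fin N // j ∈ S ∧ j ≠ i ∧ c * dist (x i) (x j) ≤ 26 / 25} = 12} := by
  sorry

/-- **S2 — LJ self-improvement: majority-twelve after cleaning ⇒ soft twelve-coordination (LJ-specific,
size XL, the hardest stub).** If every sequence of Lennard-Jones ground states is, eventually in `N`,
majority-twelve-coordinated within `26/25` after discarding `≤ N/1000` particles and dilating by
`c ∈ [1, 53/50]` to a unit packing on the kept set, then for every `η ∈ (0, 3/10)` the fraction of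
particles that do not have exactly twelve others within distance `1 + η` and none at distance in
`(1 + η, 5/4)` tends to `0` (the conclusion is verbatim `CrystalKissingRigidity.SoftTwelveCoordination`,
item 0750). Sources: Hales2012 arXiv:1209.6043 Lemma 1 (Flyspeck `L12`), BlancLewin2015 §2.2–2.3,
LucaFriesecke2016 arXiv:1605.00034 §3, Literature.Barriers.AtomisticToContinuum.IcosahedralClusters. -/
theorem stub_ljSelfImprovement :
    (∀ x : (N : ℕ) → (Fin N → EuclideanSpace ℝ (Fin 3)),
      (∀ N, Literature.MathematicalPhysics.StatisticalMechanics.IsGroundState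
        Literature.MathematicalPhysics.StatisticalMechanics.lennardJones (x N)) →
      ∀ᶠ N in Filter.atTop, ∃ (S : Finset (Fin N)) (c : ℝ), 1000 * ((N : ℝ) - S.card) ≤ N ∧ 1 ≤ c ∧
        c ≤ 53 / 50 ∧ (∀ i ∈ S, ∀ j ∈ S, i ≠ j → 1 ≤ c * dist (x N i) (x N j)) ∧
        S.card ≤ 2 * Nat.card {i : Fin N // i ∈ S ∧
          Nat.card {j : Fin N // j ∈ S ∧ j ≠ i ∧ c * dist (x N i) (x N j) ≤ 26 / 25} = 12}) →
    ∀ η : ℝ, 0 < η → η < 3 / 10 → ∀ x : (N : ℕ) → (Fin N → EuclideanSpace ℝ (Fin 3)),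
      (∀ N, Literature.MathematicalPhysics.StatisticalMechanics.IsGroundState
        Literature.MathematicalPhysics.StatisticalMechanics.lennardJones (x N)) →
      Filter.Tendsto (fun N : ℕ => (Nat.card {i : Fin N // ¬ (Nat.card {j : Fin N // j ≠ i ∧
        dist (x N i) (x N j) ≤ 1 + η} = 12 ∧ ∀ j : Fin N, j ≠ i → dist (x N i) (x N j) ≤ 1 + η ∨
        5 / 4 ≤ dist (x N i) (x N j))} : ℝ) / N) Filter.atTop (nhds 0) := by
  sorry

/-- **S3 — soft twelve-coordination ⇒ the shared hinge `BulkDefectVanish` (item 0751) (geometric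
rigidity + stacking selection, size XL).** For Lennard-Jones ground states, soft twelve-coordination at
every tolerance `η ∈ (0, 3/10)` implies that ONE periodic configuration `P` of `ℝ³` is seen, up to a
linear isometry, around all but `o(N)` particles at every window radius `R` and tolerance `ε` (robust
Fejes Tóth–Hales twelve-shell rigidity + Hägg-domination stacking selection + `O(N^{2/3})` fault planes).
Sources: Hales2012 arXiv:1209.6043 Thm 1 / Lemma 2, KusnerKusnerLagariasShlosman2018 arXiv:1611.10297,
BoroczkySzabo2016, PartayOrtnerCsanyi2017 arXiv:1705.01751, FlatleyTheil2015 arXiv:1407.0692,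
Literature.Barriers.AtomisticToContinuum.ShortRangeStackingBlindness / KissingTwelveDegeneracy. -/
theorem stub_softTwelveBulkDefectVanish :
    (∀ η : ℝ, 0 < η → η < 3 / 10 → ∀ x : (N : ℕ) → (Fin N → EuclideanSpace ℝ (Fin 3)),
      (∀ N, Literature.MathematicalPhysics.StatisticalMechanics.IsGroundState
        Literature.MathematicalPhysics.StatisticalMechanics.lennardJones (x N)) →
      Filter.Tendsto (fun N : ℕ => (Nat.card {i : Fin N // ¬ (Nat.card {j : Fin N // j ≠ i ∧
        dist (x N i) (x N j) ≤ 1 + η} = 12 ∧ ∀ j : Fin N, j ≠ i → dist (x N i) (x N j) ≤ 1 + η ∨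
        5 / 4 ≤ dist (x N i) (x N j))} : ℝ) / N) Filter.atTop (nhds 0)) →
    Summit.AtomisticToContinuum.Crystallization.Theses.ThreeConeCertificate.BulkDefectVanish := by
  sorry

/-! ## §2 Composition (kernel-checked, no `sorry`): the stub statements imply the crux BY NAME -/

/-- **Composition: S1 → S2 → S3 → `NearMaxGroundStatesCrystallize`** (hypotheses = the §0 statements by name,
definitionally the §1 signatures). The crux hypothesis and S1 give S2's hypothesis (`filter_upwards`); S2 and
S3 give `BulkDefectVanish` (item 0751); the landed soft assembly lemma `isCrystallizing_of_bulkDefectVanish`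
(item 0752) with the proved uniform minimal distance of LJ ground states (`LennardJonesMinimalDistance_holds`,
`δ = 1/3`) gives `IsCrystallizing lennardJones 3`. -/
theorem NearMaxGroundStatesCrystallize_of :
    Goal.stub_packingStabilityTwelve → Goal.stub_ljSelfImprovement → Goal.stub_softTwelveBulkDefectVanish →
    Summit.AtomisticToContinuum.Crystallization.Theses.HcpThetaUniversality.NearMaxGroundStatesCrystallize := by
  intro hS1 hS2 hS3
  unfold Goal.stub_packingStabilityTwelve at hS1
  unfold Goal.stub_ljSelfImprovement at hS2
  unfold Goal.stub_softTwelveBulkDefectVanish at hS3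
  unfold Summit.AtomisticToContinuum.Crystallization.Theses.HcpThetaUniversality.NearMaxGroundStatesCrystallize
  intro hNearMax
  -- (1) the crux hypothesis + S1: every LJ ground-state sequence is eventually majority-twelve after cleaning
  have hMaj : (∀ x : (N : ℕ) → (Fin N → EuclideanSpace ℝ (Fin 3)),
      (∀ N, Literature.MathematicalPhysics.StatisticalMechanics.IsGroundState
        Literature.MathematicalPhysics.StatisticalMechanics.lennardJones (x N)) →
      ∀ᶠ N in Filter.atTop, ∃ (S : Finset (Fin N)) (c : ℝ), 1000 * ((N : ℝ) - S.card) ≤ N ∧ 1 ≤ c ∧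
        c ≤ 53 / 50 ∧ (∀ i ∈ S, ∀ j ∈ S, i ≠ j → 1 ≤ c * dist (x N i) (x N j)) ∧
        S.card ≤ 2 * Nat.card {i : Fin N // i ∈ S ∧
          Nat.card {j : Fin N // j ∈ S ∧ j ≠ i ∧ c * dist (x N i) (x N j) ≤ 26 / 25} = 12}) := by
    intro x hx
    filter_upwards [hNearMax x hx] with N hN
    obtain ⟨S, c, hcard, hc1, hc2, hpack, hnear⟩ := hN
    exact ⟨S, c, hcard, hc1, hc2, hpack, hS1 N (x N) S c (lt_of_lt_of_le one_pos hc1) hpack hnear⟩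
  -- (2) S2: soft twelve-coordination; (3) S3: the shared hinge BulkDefectVanish (one periodic P)
  have hBDV : Summit.AtomisticToContinuum.Crystallization.Theses.ThreeConeCertificate.BulkDefectVanish :=
    hS3 (hS2 hMaj)
  unfold Summit.AtomisticToContinuum.Crystallization.Theses.ThreeConeCertificate.BulkDefectVanish at hBDV
  obtain ⟨P, hP⟩ := hBDV
  -- (4) landed soft assembly lemma (item 0752) + uniform minimal distance of LJ ground states (proved fact)
  have hmin : Literature.MathematicalPhysics.StatisticalMechanics.LennardJonesMinimalDistance :=
    Literature.MathematicalPhysics.StatisticalMechanics.LennardJonesMinimalDistance_holds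
  unfold Literature.MathematicalPhysics.StatisticalMechanics.LennardJonesMinimalDistance at hmin
  obtain ⟨δ, hδ, hsep⟩ := hmin
  exact Summit.AtomisticToContinuum.Crystallization.Theorems.ThreeConeCertificateDefectVanishCrystallizes.isCrystallizing_of_bulkDefectVanish
    P hP hδ hsep

/-- **The registered skeleton in one line**: the three §1 stubs fed into `NearMaxGroundStatesCrystallize_of`
prove the crux by name (the Goal statements unfold to the stub signatures; `#print axioms` reaches `sorryAx`
exactly through the three stubs). -/
theorem nearMaxGroundStatesCrystallize_skeleton :
    Summit.AtomisticToContinuum.Crystallization.Theses.HcpThetaUniversality.NearMaxGroundStatesCrystallize :=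
  NearMaxGroundStatesCrystallize_of stub_packingStabilityTwelve stub_ljSelfImprovement
    stub_softTwelveBulkDefectVanish

end Summit.AtomisticToContinuum.Crystallization.Cruxes.NearMaxGroundStatesCrystallize.Birth
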